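import Mathlib

/-!
# SoloBlind kernel #78 — promoted contacts are capped by the window vertex

Leaf-level algebra behind the CONTACT LAW of the steady door (solo-blind paper §24.20(9), claim SB-C400).
A zero-amplitude leaf sitting outside the Thomas–Fermi band (local supercriticality `S < 0`) can be held
marginal only by shear PROMOTION `promo b κ μ = b μ - κ μ²` (the quadratic shear window of kernels #73–#77,
`κ > 0`).  Three facts used by the contact law:

* `promo_le_vertex` : promotion never exceeds the vertex value `b² / (4 κ)`;
* `promo_pos_sign`  : positive promotion forces `b μ > 0`, i.e. the contact shear has the sign of `b`
  (combined with the kinematic sign of the contact shear this is the signed design criterion);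
* `no_marginal_leaf_beyond_fold` : where the required promotion `s` exceeds `b² / (4 κ)` no shear makes the
  leaf marginal — the contact cannot lie beyond the fold `|S| = b²/(4κ)`;
* `vertex_attains` : the cap is attained exactly at the vertex shear `μ = b / (2 κ)`;
* `detuned_contact_recedes` : for a DETUNED contact inside the band (`S (x_c) = κ μ² - b μ` with `b μ ≤ 0`),
  the required supercriticality grows at least like `κ μ²`, so a growing contact shear pushes the contact to
  larger `S`, i.e. inward (erosion of the P0 carrier).
-/

namespace Summit.AnomalousDissipation.AnomalousDissipation.Theorems

/-- Shear promotion of a leaf's growth rate by mean shear `μ` in a quadratic window with slope `b` and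
curvature `κ`. -/
noncomputable def promo (b κ μ : ℝ) : ℝ := b * μ - κ * μ ^ 2

/-- Promotion is capped by the vertex value `b² / (4κ)` of the quadratic window. -/
theorem promo_le_vertex (b κ μ : ℝ) (hκ : 0 < κ) : promo b κ μ ≤ b ^ 2 / (4 * κ) := by
  unfold promo
  rw [le_div_iff₀ (by positivity)]
  nlinarith [sq_nonneg (2 * κ * μ - b)]

/-- The cap is attained at the vertex shear `μ = b / (2κ)`. -/
theorem vertex_attains (b κ : ℝ) (hκ : 0 < κ) : promo b κ (b / (2 * κ)) = b ^ 2 / (4 * κ) := by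
  unfold promo
  field_simp
  ring

/-- Positive promotion forces the shear to have the sign of `b` (`b μ > 0`). -/
theorem promo_pos_sign (b κ μ : ℝ) (hκ : 0 < κ) (h : 0 < promo b κ μ) : 0 < b * μ := by
  unfold promo at h
  nlinarith [sq_nonneg μ]

/-- Beyond the fold no shear keeps a zero-amplitude leaf marginal: if the promotion required is
`s > b²/(4κ)`, the equation `promo b κ μ = s` has no solution. -/
theorem no_marginal_leaf_beyond_fold (b κ s : ℝ) (hκ : 0 < κ) (hs : b ^ 2 / (4 * κ) < s) :
    ¬ ∃ μ : ℝ, promo b κ μ = s := by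
  rintro ⟨μ, hμ⟩
  have := promo_le_vertex b κ μ hκ
  linarith

/-- Inside the fold the promoted contact has room: any required promotion `s` with `0 ≤ s ≤ b²/(4κ)` is
delivered by a shear `μ` with `b μ ≥ 0` (the near root), bounded by the vertex shear `|b| / (2κ)`. -/
theorem promoted_contact_feasible (b κ s : ℝ) (hκ : 0 < κ) (hs0 : 0 ≤ s) (hs : s ≤ b ^ 2 / (4 * κ)) :
    ∃ μ : ℝ, promo b κ μ = s ∧ 0 ≤ b * μ ∧ |μ| ≤ |b| / (2 * κ) := by
  have hd : 0 ≤ b ^ 2 - 4 * κ * s := by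
    rw [le_div_iff₀ (by positivity)] at hs
    linarith
  set r := Real.sqrt (b ^ 2 - 4 * κ * s) with hr
  have hr0 : 0 ≤ r := Real.sqrt_nonneg _
  have hr2 : r ^ 2 = b ^ 2 - 4 * κ * s := by rw [hr, Real.sq_sqrt hd]
  have hrb : r ≤ |b| := by
    rw [← Real.sqrt_sq_eq_abs]
    exact Real.sqrt_le_sqrt (by nlinarith)
  have key : (b - r) * (b + r) = 4 * κ * s := by nlinarith [hr2]
  have hκ0 : κ ≠ 0 := ne_of_gt hκ
  rcases le_or_gt 0 b with hb | hb
  · -- b ≥ 0 : near root μ = (b - r) / (2κ) ∈ [0, b / (2κ)]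
    have hbr : 0 ≤ b - r := by rw [abs_of_nonneg hb] at hrb; linarith
    refine ⟨(b - r) / (2 * κ), ?_, ?_, ?_⟩
    · have h1 : promo b κ ((b - r) / (2 * κ)) = (b - r) * (b + r) / (4 * κ) := by
        unfold promo; field_simp; ring
      rw [h1, key]; field_simp
    · exact mul_nonneg hb (div_nonneg hbr (by positivity))
    · rw [abs_div, abs_of_pos (by positivity : (0:ℝ) < 2 * κ), abs_of_nonneg hbr, abs_of_nonneg hb]
      exact div_le_div_of_nonneg_right (by linarith) (by positivity)
  · -- b < 0 : near root μ = (b + r) / (2κ) ∈ [b / (2κ), 0]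
    have hbr : b + r ≤ 0 := by rw [abs_of_neg hb] at hrb; linarith
    refine ⟨(b + r) / (2 * κ), ?_, ?_, ?_⟩
    · have h1 : promo b κ ((b + r) / (2 * κ)) = (b + r) * (b - r) / (4 * κ) := by
        unfold promo; field_simp; ring
      rw [h1, mul_comm (b + r), key]; field_simp
    · have : b * ((b + r) / (2 * κ)) = (-b) * (-(b + r)) / (2 * κ) := by ring
      rw [this]
      exact div_nonneg (mul_nonneg (by linarith) (by linarith)) (by positivity)
    · rw [abs_div, abs_of_pos (by positivity : (0:ℝ) < 2 * κ), abs_of_nonpos hbr, abs_of_neg hb]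
      exact div_le_div_of_nonneg_right (by linarith) (by positivity)

/-- A DETUNED contact inside the band: if the contact leaf is marginal with the shear working against it
(`b μ ≤ 0`), the local supercriticality it consumes is at least `κ μ²` — growing contact shear forces the
contact to larger `S`, i.e. inward (recession / erosion). -/
theorem detuned_contact_recedes (b κ μ S : ℝ) (hS : S = κ * μ ^ 2 - b * μ) (hbμ : b * μ ≤ 0) :
    κ * μ ^ 2 ≤ S := by
  rw [hS]; linarith

end Summit.AnomalousDissipation.AnomalousDissipation.Theorems
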